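import Mathlib
import Summits.MatrixMultiplication.MatrixMultiplication.Theses.HiddenToeplitzCorners

/-!
# Apolar kernel placement — typed record for the crux-plan verdict (NO-SKELETON)

Crux `HiddenCorners` (stmt-MatrixMultiplication-7492), idea `apolar-kernel-placement`.
This file is NOT a registered line (published as `Cruxes/HiddenCorners/ApolarKernelPlacement.lean`).
It certifies that the statements quoted in `Lines/apolar-kernel-placement.md` elaborate:

* `hankelPencil`            — the honest (δ = 2) Hankel pencil `H_W(X) i j = tr (X * W (i + j))`;
* `HonestHankelCorners`     — the card's transfer target C⁺(δ = 2), typed (with the crux's sparsity budget);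
* `transfer`                — C⁺(δ = 2) → HiddenCorners (what WOULD have been `stub_transfer`; provable-now,
                              flip `J`, split generators `e₀`, first row / first column) — `sorry` here;
* `hankel_square_identity`  — the card's First lemma (true as typed, triage ×3) — `sorry` here, disproof-side tool;
* `HonestHankelRankLeTwo`   — the Negative-lemma target all three triagers name ("δ = 2 nondegenerate ⇒ r ≤ 2"),
                              and the proved one-liner `not_honestHankelCorners_of_rankLeTwo`.
-/

set_option linter.dupNamespace false

namespace Summit.MatrixMultiplication.MatrixMultiplication.Cruxes.HiddenCorners.ApolarKernelPlacement

open scoped BigOperators Matrix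
open Summit.MatrixMultiplication.MatrixMultiplication.Theses.HiddenToeplitzCorners

/-- The honest Hankel pencil of a placement `W : ℕ → M_r(ℂ)`: `H_W(X) i j = tr (X * W (i + j))`,
indices added in `ℕ` (no wrap-around; `W k` for `k ≥ 2N-1` is never read). -/
noncomputable def hankelPencil (r N : ℕ) (W : ℕ → Matrix (Fin r) (Fin r) ℂ)
    (X : Matrix (Fin r) (Fin r) ℂ) : Matrix (Fin N) (Fin N) ℂ :=
  Matrix.of fun i j : Fin N => (X * W ((i : ℕ) + (j : ℕ))).trace

/-- **C⁺(δ = 2)** (card `apolar-kernel-placement`, §Transfer), typed: for every `ε > 0` and infinitely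
many `r` there is an honest Hankel pencil of size `N ≤ r^(2+ε)` whose placement has total sparsity
`Σ_k nnz (W k) ≤ r^(2+ε)`, generically nonsingular, and singular on every singular `X`.
Equivalently (Sylvester): `D_r` is a component of the linear section `W̃^*(Cat_N)` of the catalecticant
hypersurface and the section is proper. -/
def HonestHankelCorners : Prop :=
  ∀ ε : ℝ, 0 < ε → ∃ᶠ r : ℕ in Filter.atTop, ∃ N : ℕ, (N : ℝ) ≤ (r : ℝ) ^ (2 + ε) ∧
    ∃ W : ℕ → Matrix (Fin r) (Fin r) ℂ, (∀ k, 2 * N - 1 ≤ k → W k = 0) ∧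
      (((∑ k ∈ Finset.range (2 * N - 1),
          (Finset.univ.filter fun p : Fin r × Fin r => W k p.1 p.2 ≠ 0).card : ℕ) : ℝ)
            ≤ (r : ℝ) ^ (2 + ε)) ∧
      (∃ X₀ : Matrix (Fin r) (Fin r) ℂ, (hankelPencil r N W X₀).det ≠ 0) ∧
      ∀ X : Matrix (Fin r) (Fin r) ℂ, X.det = 0 → (hankelPencil r N W X).det = 0

/-- What would have been `stub_transfer`: C⁺(δ = 2) → the crux.  Proof route (not formalised here):
`T a b := (Hankel of the symbol k ↦ W k b a) * J` with `J` the flip; `T(X) = H_W(X) * J` is Toeplitz,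
`T - Z T Zᵀ = e₀ (row 0)ᵀ + (col 0 with entry 0 zeroed) e₀ᵀ`, so `d = 1`, `G₀ = H₀ = e₀`,
`H₁ a b` = row 0, `G₁ a b` = column 0 of `T a b`; generator sparsity ≤ `Σ_k nnz (W k)`;
`det T(X) = ± det H_W(X)`. -/
theorem transfer : HonestHankelCorners → HiddenCorners := by
  sorry

/-- The card's First lemma (square identity), over `hankelPencil`: at a singular `X` where `H_W(X)` has
corank exactly one with kernel spanned by `c`, the placement maps `c · c` onto a multiple of `adj X`.
True as typed (TRIAGE-r1-1/2/3); it is disproof-side calculus, recorded here for the disprover. -/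
theorem hankel_square_identity (r N : ℕ) (W : ℕ → Matrix (Fin r) (Fin r) ℂ)
    (hS : ∀ Y : Matrix (Fin r) (Fin r) ℂ, Y.det = 0 → (hankelPencil r N W Y).det = 0)
    (X : Matrix (Fin r) (Fin r) ℂ) (hX : X.det = 0) (c : Fin N → ℂ) (hc : c ≠ 0)
    (hker : ∀ c' : Fin N → ℂ, (hankelPencil r N W X).mulVec c' = 0 ↔ ∃ t : ℂ, c' = t • c) :
    ∃ γ : ℂ, (∑ i : Fin N, ∑ j : Fin N, (c i * c j) • W ((i : ℕ) + (j : ℕ))) = γ • X.adjugate := by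
  sorry

/-- The Negative-lemma target named by all three triagers ("honest δ = 2, nondegenerate ⇒ r ≤ 2",
every kernel degree, no sparsity hypothesis).  OPEN; all censuses on record support it. -/
def HonestHankelRankLeTwo : Prop :=
  ∀ (r N : ℕ) (W : ℕ → Matrix (Fin r) (Fin r) ℂ),
    (∃ X₀ : Matrix (Fin r) (Fin r) ℂ, (hankelPencil r N W X₀).det ≠ 0) →
    (∀ X : Matrix (Fin r) (Fin r) ℂ, X.det = 0 → (hankelPencil r N W X).det = 0) → r ≤ 2

/-- The Negative lemma kills C⁺(δ = 2) (and with it any line on this card). -/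
theorem not_honestHankelCorners_of_rankLeTwo (h : HonestHankelRankLeTwo) :
    ¬ HonestHankelCorners := by
  intro hC
  have hfreq := hC 1 one_pos
  have hle : ∃ᶠ r : ℕ in Filter.atTop, r ≤ 2 := by
    refine hfreq.mono ?_
    rintro r ⟨N, -, W, -, -, hX₀, hsing⟩
    exact h r N W hX₀ hsing
  obtain ⟨r, hr, hgt⟩ := (hle.and_eventually (Filter.eventually_gt_atTop 2)).exists
  omega

end Summit.MatrixMultiplication.MatrixMultiplication.Cruxes.HiddenCorners.ApolarKernelPlacement
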